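import Literature.AlgebraicGeometry.HodgeTheory.NonCMEllipticCurvePowersHodgeClasses
import Literature.AlgebraicGeometry.Motives.AimedSplitProductProofs
import Literature.AlgebraicGeometry.VanGeemen1994.WeilTypeHodgeGroupSU
import Literature.AlgebraicGeometry.Milne1999.SpecialLefschetzGroupOneEqUnitaryCentralizer
import Literature.AlgebraicGeometry.HodgeTheory.WeilTypePeriodPoint
import Literature.AlgebraicGeometry.HodgeTheory.HolomorphicBundleChernCharacterTopDegree
import Literature.AlgebraicGeometry.HodgeTheory.HodgeGroupExteriorAction
import Literature.AlgebraicGeometry.HodgeTheory.HyperplaneClassRational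
import HarnessLib

/-!
# The square of a non-CM elliptic curve as an abelian surface of Weil type: `Hod = SU_H`, and the
# vendored form of van Geemen's Theorem 6.12 (`0 < n`) is FALSE at `n = 1`

Pure Literature (theorems only: no new definition, no new named fact, no Summit import).

## What is proved

For a complex elliptic curve `E` WITHOUT complex multiplication in the tree's Hodge-theoretic sense
(`HodgeTheory.EllipticCurve.HodgeEndTrivial E`: every rational, type-preserving `ℂ`-linear endomorphism of
`H¹(E(ℂ); ℂ)` is a scalar — Moonen–Zarhin 1999 §2, `g = 1`, Type I(1)), the abelian surface `X = E × E`
with the rotation `J = (0, -1; 1, 0)` (`J ≫ p₁ = -p₂`, `J ≫ p₂ = p₁`, so `J² = -1`, `K = ℚ(i) ⊂ End⁰(X)`):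

* `NonCMSquare.finrank_eigenspace_inf_hodgeOneZero` — `(X, K)` is of Weil type with `n = d = 1`
  (`dim (V_i ∩ H^{1,0}) = 1`), hence (`NonCMSquare.isOfHodgeType_of_mem_weilClassesOf_rot`) its Weil
  plane `W_K ⊗ ℂ = weilClassesOf X J 1 1 ⊂ H²` consists of Hodge classes [van Geemen 5.2–5.4, 4.10];
* `NonCMSquare.weilSpecialUnitaryGroup_le_unitaryCentralizerGroup` — for the `K`-symmetrised hyperplane
  class `h_K = e^*a + J^*e^*a` of ANY projective embedding `e` (`a ≠ 0` rational on `ℙᴺ`), every element of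
  van Geemen's `SU_H(ℂ)` (`weilSpecialUnitaryGroup`: commutes with `J^*`, preserves `Q_{h_K}`, determinant
  `1` on both eigenspaces of `J^*`) commutes with EVERY endomorphism pull-back on `H¹(X(ℂ); ℂ)`, i.e. lies
  in Milne's `U(C)(h_K)` (`Milne1999.unitaryCentralizerGroup`);
* `NonCMSquare.isDivisorGenerated_powSucc` — every power of `E × E` has `B• = D•` (Tate / Murasaki /
  Gordon §3, the tree's `EllSlots.hodgeClasses_divisorial`);
* `NonCMSquare.hasHodgeGroupSU` — **`Hod(E × E) = SU_H`** in van Geemen's sense (`HasHodgeGroupSU X J 1 1 h_K`,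
  6.11): `Hod ≤ SU_H` always (`hodgeGroupOne_le_weilSpecialUnitaryGroup`), and `SU_H ≤ U(C)(h_K) = S(X) =
  Hod|_{H¹}` by the previous two items and Milne 1999 Thm. 4.4 in the tree's proved form
  `Milne1999.hodgeGroupOne_eq_unitaryCentralizerGroup_of_forall_isDivisorGenerated'`;
* `not_vanGeemen1994_thm612_of_hodgeEndTrivial` — **the named fact `VanGeemen1994_thm612` (file
  `WeilTypeHodgeGroupSU`, quantified over `0 < n`) is false**: at `(A, φ, n, d) = (E × E, J, 1, 1)` all its
  hypotheses hold, while its last conjunct `Disjoint (D¹ ⊗ ℂ) (W_K ⊗ ℂ)` fails, `W_K ⊗ ℂ` being a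
  `2`-dimensional (`finrank_weilClassesOf_eq_two`) space of rational `(1,1)`-classes, i.e. of divisor
  classes (`divisorMonomials _ _ 1 = {1 ∪ b}`, `D¹ = B¹`).

The unconditional corollary `¬ VanGeemen1994_thm612` needs one non-CM elliptic curve; its existence is the
Summits-side theorem `Summit.HodgeConjecture.CorCM.NonCMCurve.exists_ellipticCurve_hodgeEndTrivial`
(Riemann's essential-image theorem is proved Summits-side), so that corollary is filed under `Summits/`.
The CORRECTED statement (`2 ≤ n`; van Geemen's Thm. 4.11 carries the printed proviso "with `n > 1`") is
the tree's theorem `VanGeemen1994_thm612_corrected_holds` (file `WeilTypeHodgeRingOfSU`); this file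
supplies the kernel witness that the correction was necessary.

## Architecture (van Geemen 5.2–5.4 for `E × E ⊂ ℚ(i)`; Milne 1999 §4; Moonen–Zarhin Type I(1))

1. Notation of the comments: `p₁, p₂ = fst E E, snd E E` the projections, `ι₁ = prodLift (𝟙 E) 0`,
   `ι₂ = prodLift 0 (𝟙 E)` the axes. `H¹(E × E) = p₁^*H¹(E) ⊕ p₂^*H¹(E)` (`eq_map_p₁_add_map_p₂`, the
   biproduct identity `p₁ ≫ ι₁ + p₂ ≫ ι₂ = 𝟙`); `J^*p₁^* = -p₂^*`, `J^*p₂^* = p₁^*`; the `±i`-eigenspaces of `J^*` are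
   `{p₁^*w ± i p₂^*w}` (`eq_of_mem_eigenspace_rot`).
2. Non-CM input (`bilin_self_eq_zero_of_hodgeEndTrivial`, "Lemma K"): a bilinear map `β` on `H¹(E)` with
   values in a rational line, rational on rational classes and isotropic on `H^{1,0}` and on `H^{0,1}`, is
   ALTERNATING — the operator `T` with `ω₀(Tx, y) = β(x, y)ℓ` is rational and type-preserving, hence a
   scalar by `HodgeEndTrivial`, which forces the Gram matrix of `β` to be antisymmetric. Applied to the cross
   pairing `β(w, w') = Q_{h_K}(p₁^*w, p₂^*w')` (symmetric by `J^*`-invariance of `Q_{h_K}`): `β = 0`, so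
   `Q_{h_K}` is block-diagonal, `Q(p₂^*w, p₂^*w') = Q(p₁^*w, p₁^*w') =: γ(w, w')`, `γ` non-degenerate (hard
   Lefschetz for `h_K`, a non-zero real multiple of a Kähler class, `exists_isKaehlerClass_ksymm_eq_smul`).
3. An element `u ∈ SU_H(ℂ)` preserves both eigenspaces; read on `H¹(E)` through `w ↦ p₁^*w ± i p₂^*w` it is a
   pair `(g, g')` with `det g = det g' = 1`; `Q`-invariance gives `γ(gw, g'w') = γ(w, w')`, `det g = 1` gives
   `γ(gw, gw') = γ(w, w')` (`bilin_apply_apply_eq_det_smul`, `dim H¹(E) = 2`), so `g' = g` and `u = g ⊕ g`,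
   which commutes with every `ψ^*`, `ψ ∈ End(E × E) = M₂(ℤ)` acting through scalar `2 × 2` blocks
   (`exists_map_map_p_eq`, `comm_map_of_diag`).
4. `Hod|_{H¹} = U(C)(h)` for `h` rational with a positive multiple Kähler and `B• = D•` on all powers (Milne
   Thm. 4.4, tree theorem); `B• = D•` on the powers of `E × E` by the slot structures `EllSlots` (Tate).
5. Balancedness: `p₁^*ω + i p₂^*ω ∈ V_i ∩ H^{1,0}` and `p₁^*ω̄ + i p₂^*ω̄ ∈ V_i ∩ H^{0,1}` are non-zero, and the
   two dimensions add up to `2` (`finrank_inf_hodgeOneZero_add_finrank_inf_hodgeZeroOne`).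
6. Refutation: instantiate the fact, bound `W_K ⊗ ℂ ≤ D¹ ⊗ ℂ` through `weilClassesOf_eq_span_isRationalClass`
   and `mem_divisorMonomials_one`, and compare with `finrank (W_K ⊗ ℂ) = 2`.

## References

* [vanGeemen1994HodgeAV] B. van Geemen, *An introduction to the Hodge conjecture for abelian varieties*,
  LNM 1594 (1994): 2.4 (`D ⊂ B`), 4.10–4.11, Lemma 5.2, 5.4 (`E × E ⊂ ℚ(i)`), 6.11–6.12.
* [Milne1999LefschetzClasses] J. S. Milne, *Lefschetz classes on abelian varieties*, Duke Math. J. 96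
  (1999), Thm. 4.4, Prop. 4.8.
* [MoonenZarhin1999LowDim] B. Moonen, Yu. Zarhin, *Hodge classes on abelian varieties of low dimension*,
  Math. Ann. 315 (1999), §2 (`g = 1`, Type I(1)).
* [Gordon1997] B. B. Gordon, *A survey of the Hodge conjecture for abelian varieties* (1997), §3 (Tate,
  Murasaki: powers of an elliptic curve).
* [LangeBirkenhake1992] H. Lange, Ch. Birkenhake, *Complex Abelian Varieties* (1992), §1.2, Thm. 4.2.1.

HONEST SCOPE: nothing here bears on the Hodge conjecture itself; the file shows that one vendored
hypothesis of the tree is contradictory (every theorem carrying a binder `(h : VanGeemen1994_thm612)` is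
vacuous) and records the positive statement `Hod(E × E) = SU_H` for non-CM `E`.
-/

noncomputable section

open CategoryTheory
open Literature.AlgebraicTopology.SingularHomology
open Literature.AlgebraicGeometry.Motives (IsSmoothProjective AbelianVariety polarizationPairingOne)

namespace Literature.AlgebraicGeometry.VanGeemen1994

open Literature.AlgebraicGeometry.HodgeTheory

namespace NonCMSquare

section Curve

variable {E : AbelianVariety ℂ}

/-- Every endomorphism `ψ` of an elliptic curve `E` without complex multiplication (Hodge-theoretically:
`EllipticCurve.HodgeEndTrivial E`) acts on `H¹(E(ℂ); ℂ)` by a scalar (`ψ^*` is rational and preserves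
the Hodge types). [cite: MoonenZarhin1999LowDim, §2 (g = 1), Type I(1)] -/
theorem exists_map_one_eq_smul (hT : EllipticCurve.HodgeEndTrivial E) (ψ : E ⟶ E) :
    ∃ c : ℂ, ∀ x : complexBetti E.X 1, complexBetti.map ψ.hom.hom.hom 1 x = c • x := by
  have hX : IsSmoothProjective E.dim E.X := Motives.AbelianVariety.isSmoothProjective_holds
  obtain ⟨z, hz⟩ := hT (complexBetti.map ψ.hom.hom.hom 1).hom (fun x hx => hx.map _)
    (fun x hx => hx.map_of_isSmoothProjective hX hX _) (fun x hx => hx.map_of_isSmoothProjective hX hX _)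
  refine ⟨z, fun x => ?_⟩
  change (complexBetti.map ψ.hom.hom.hom 1).hom x = z • x
  rw [hz]; rfl

/-- Expansion of a vector in a basis indexed by `Fin 2`. [folklore] -/
private theorem eq_coord_smul_add {V : Type*} [AddCommGroup V] [Module ℂ V] (e : Module.Basis (Fin 2) ℂ V)
    (x : V) : x = e.coord 0 x • e 0 + e.coord 1 x • e 1 := by
  conv_lhs => rw [← e.sum_repr x, Fin.sum_univ_two]
  rfl

/-- Coordinates of a combination of the basis vectors. [folklore] -/
private theorem coord_smul_add {V : Type*} [AddCommGroup V] [Module ℂ V] (e : Module.Basis (Fin 2) ℂ V)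
    (a b : ℂ) : e.coord 0 (a • e 0 + b • e 1) = a ∧ e.coord 1 (a • e 0 + b • e 1) = b := by
  constructor <;> simp [Module.Basis.coord_apply, Module.Basis.repr_self]

/-- Two vectors of a `2`-dimensional space with vanishing coordinate determinant against a basis are
proportional (the second being non-zero). [folklore] -/
private theorem exists_eq_smul_of_coord_det_eq_zero {V : Type*} [AddCommGroup V] [Module ℂ V]
    (e : Module.Basis (Fin 2) ℂ V) {z x : V} (hx : x ≠ 0)
    (h : e.coord 0 z * e.coord 1 x - e.coord 1 z * e.coord 0 x = 0) : ∃ c : ℂ, z = c • x := by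
  have hx' : e.coord 0 x ≠ 0 ∨ e.coord 1 x ≠ 0 := by
    by_contra hcon
    push Not at hcon
    apply hx
    rw [eq_coord_smul_add e x, hcon.1, hcon.2, zero_smul, zero_smul, add_zero]
  -- it suffices to compare coordinates
  suffices hc : ∃ c : ℂ, e.coord 0 z = c * e.coord 0 x ∧ e.coord 1 z = c * e.coord 1 x by
    obtain ⟨c, h0, h1⟩ := hc
    refine ⟨c, ?_⟩
    calc z = e.coord 0 z • e 0 + e.coord 1 z • e 1 := eq_coord_smul_add e z
      _ = (c * e.coord 0 x) • e 0 + (c * e.coord 1 x) • e 1 := by rw [h0, h1]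
      _ = c • (e.coord 0 x • e 0 + e.coord 1 x • e 1) := by rw [smul_add, smul_smul, smul_smul]
      _ = c • x := by rw [← eq_coord_smul_add e x]
  rcases hx' with h0 | h1
  · refine ⟨e.coord 0 z / e.coord 0 x, ?_, ?_⟩
    · rw [div_mul_cancel₀ _ h0]
    · field_simp
      linear_combination (-1 : ℂ) * h
  · refine ⟨e.coord 1 z / e.coord 1 x, ?_, ?_⟩
    · field_simp
      linear_combination h
    · rw [div_mul_cancel₀ _ h1]

/-- **The non-CM input (abstract form).** For an elliptic curve `E` without complex multiplication
(Hodge-theoretically) and a bilinear map `β` on `H¹(E(ℂ); ℂ)` with values in a line `ℂ ℓ` which is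
RATIONAL (rational classes pair to `ℚ ℓ`) and for which the classes of type `(1,0)` and of type `(0,1)`
are isotropic, `β` is alternating.
[cite: MoonenZarhin1999LowDim, §2 (g = 1), Type I(1)] [cite: Gordon1997, §3] -/
theorem bilin_self_eq_zero_of_hodgeEndTrivial (hE : E.dim = 1) (hT : EllipticCurve.HodgeEndTrivial E)
    {L : Type*} [AddCommGroup L] [Module ℂ L]
    (β : complexBetti E.X 1 →ₗ[ℂ] complexBetti E.X 1 →ₗ[ℂ] L) {ℓ : L} (hℓ : ℓ ≠ 0)
    (hrat : ∀ x y, IsRationalClass x → IsRationalClass y → ∃ q : ℚ, β x y = (q : ℂ) • ℓ)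
    (h10 : ∀ x, IsOfHodgeType E.dim E.X 1 1 0 x → β x x = 0)
    (h01 : ∀ x, IsOfHodgeType E.dim E.X 1 0 1 x → β x x = 0)
    (w : complexBetti E.X 1) : β w w = 0 := by
  classical
  obtain ⟨e, he⟩ := EllipticCurve.exists_rational_basis hE
  -- rational Gram matrix `q`
  choose q hq using fun i j => hrat (e i) (e j) (he i) (he j)
  -- the scalar form `B` with `β = B • ℓ`
  let B : complexBetti E.X 1 → complexBetti E.X 1 → ℂ := fun x y =>
    e.coord 0 x * e.coord 0 y * (q 0 0 : ℂ) + e.coord 0 x * e.coord 1 y * (q 0 1 : ℂ) +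
      e.coord 1 x * e.coord 0 y * (q 1 0 : ℂ) + e.coord 1 x * e.coord 1 y * (q 1 1 : ℂ)
  have hβ : ∀ x y, β x y = B x y • ℓ := by
    intro x y
    conv_lhs => rw [eq_coord_smul_add e x, eq_coord_smul_add e y]
    simp only [map_add, map_smul, LinearMap.add_apply, LinearMap.smul_apply, hq, B]
    module
  have hB0 : ∀ x, β x x = 0 → B x x = 0 := by
    intro x hx
    have h := hβ x x
    rw [hx] at h
    exact (smul_eq_zero.1 h.symm).resolve_right hℓ
  -- the operator `T` with `ω₀(T x, y) = B(x, y)`, `ω₀` the coordinate symplectic form of `e`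
  let T : complexBetti E.X 1 →ₗ[ℂ] complexBetti E.X 1 :=
    e.constr ℂ fun i => (q i 1 : ℂ) • e 0 - (q i 0 : ℂ) • e 1
  have hTe : ∀ i, T (e i) = (q i 1 : ℂ) • e 0 - (q i 0 : ℂ) • e 1 := fun i => by
    simp [T]
  have hTx : ∀ x, T x = (e.coord 0 x * (q 0 1 : ℂ) + e.coord 1 x * (q 1 1 : ℂ)) • e 0 +
      (-(e.coord 0 x * (q 0 0 : ℂ) + e.coord 1 x * (q 1 0 : ℂ))) • e 1 := by
    intro x
    conv_lhs => rw [eq_coord_smul_add e x]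
    rw [map_add, map_smul, map_smul, hTe, hTe]
    module
  have hc0 : ∀ x, e.coord 0 (T x) = e.coord 0 x * (q 0 1 : ℂ) + e.coord 1 x * (q 1 1 : ℂ) := fun x => by
    rw [hTx]; exact (coord_smul_add e _ _).1
  have hc1 : ∀ x, e.coord 1 (T x) = -(e.coord 0 x * (q 0 0 : ℂ) + e.coord 1 x * (q 1 0 : ℂ)) := fun x => by
    rw [hTx]; exact (coord_smul_add e _ _).2
  -- `ω₀(T x, x) = B(x, x)`
  have hω : ∀ x, e.coord 0 (T x) * e.coord 1 x - e.coord 1 (T x) * e.coord 0 x = B x x := by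
    intro x
    rw [hc0, hc1]
    simp only [B]
    ring
  -- `T` preserves rational classes
  have hTrat : ∀ x, IsRationalClass x → IsRationalClass (T x) := by
    intro x hx
    obtain ⟨v, hv⟩ := exists_rat_coords_of_rational_basis e he hx
    rw [Fin.sum_univ_two] at hv
    have hv0 : e.coord 0 x = (v 0 : ℂ) := by rw [hv]; exact (coord_smul_add e _ _).1
    have hv1 : e.coord 1 x = (v 1 : ℂ) := by rw [hv]; exact (coord_smul_add e _ _).2
    rw [hTx, hv0, hv1]
    have e1 : ((v 0 : ℚ) : ℂ) * (q 0 1 : ℂ) + ((v 1 : ℚ) : ℂ) * (q 1 1 : ℂ) =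
        ((v 0 * q 0 1 + v 1 * q 1 1 : ℚ) : ℂ) := by push_cast; ring
    have e2 : -(((v 0 : ℚ) : ℂ) * (q 0 0 : ℂ) + ((v 1 : ℚ) : ℂ) * (q 1 0 : ℂ)) =
        ((-(v 0 * q 0 0 + v 1 * q 1 0) : ℚ) : ℂ) := by push_cast; ring
    rw [e1, e2]
    exact ((he 0).smul _).add ((he 1).smul _)
  -- `T` preserves the Hodge types `(1,0)` and `(0,1)`
  have hTtype : ∀ (p r : ℕ), (∀ x, IsOfHodgeType E.dim E.X 1 p r x → β x x = 0) →
      ∀ x, IsOfHodgeType E.dim E.X 1 p r x → IsOfHodgeType E.dim E.X 1 p r (T x) := by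
    intro p r hiso x hx
    by_cases hx0 : x = 0
    · rw [hx0, map_zero]; rw [hx0] at hx; exact hx
    have hdet : e.coord 0 (T x) * e.coord 1 x - e.coord 1 (T x) * e.coord 0 x = 0 := by
      rw [hω]; exact hB0 x (hiso x hx)
    obtain ⟨c, hc⟩ := exists_eq_smul_of_coord_det_eq_zero e hx0 hdet
    rw [hc]; exact hx.smul c
  obtain ⟨z, hz⟩ := hT T hTrat (hTtype 1 0 h10) (hTtype 0 1 h01)
  -- read off the Gram matrix: `q 0 0 = q 1 1 = 0`, `q 0 1 = -q 1 0`
  have hz0 := hTe 0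
  have hz1 := hTe 1
  rw [hz] at hz0 hz1
  simp only [LinearMap.smul_apply, LinearMap.id_coe, id_eq] at hz0 hz1
  -- `z • e 0 = q01 • e 0 - q00 • e 1`, `z • e 1 = q11 • e 0 - q10 • e 1`
  have e00 := congrArg (e.coord 1) hz0
  have e01 := congrArg (e.coord 0) hz0
  have e11 := congrArg (e.coord 0) hz1
  have e10 := congrArg (e.coord 1) hz1
  simp [Module.Basis.coord_apply, Module.Basis.repr_self] at e00 e01 e11 e10
  -- conclude
  rw [hβ]
  have hq00 : (q 0 0 : ℂ) = 0 := by rw [e00, Rat.cast_zero]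
  have hq11 : (q 1 1 : ℂ) = 0 := e11.symm
  have hq01 : (q 0 1 : ℂ) = -(q 1 0 : ℂ) := e01.symm.trans e10
  have : B w w = 0 := by
    simp only [B]
    rw [hq00, hq11, hq01]
    ring
  rw [this, zero_smul]

end Curve

section Square

variable {E : AbelianVariety ℂ}

open Literature.AlgebraicGeometry.Motives.AbelianVariety (fst snd prodLift)

/-! ### `H¹(E × E) = p₁^* H¹(E) ⊕ p₂^* H¹(E)` -/

/-- `ι₁ ≫ p₁ = 𝟙`, `ι₁ ≫ p₂ = 0`, `ι₂ ≫ p₁ = 0`, `ι₂ ≫ p₂ = 𝟙`. [folklore] -/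
private theorem ι_comp_p :
    (prodLift (𝟙 E) (0 : E ⟶ E) ≫ fst E E = 𝟙 E ∧ prodLift (𝟙 E) (0 : E ⟶ E) ≫ snd E E = 0) ∧
      (prodLift (0 : E ⟶ E) (𝟙 E) ≫ fst E E = 0 ∧ prodLift (0 : E ⟶ E) (𝟙 E) ≫ snd E E = 𝟙 E) :=
  ⟨⟨Motives.AbelianVariety.prodLift_fst _ _, Motives.AbelianVariety.prodLift_snd _ _⟩,
    ⟨Motives.AbelianVariety.prodLift_fst _ _, Motives.AbelianVariety.prodLift_snd _ _⟩⟩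

/-- `p₁ ≫ ι₁ + p₂ ≫ ι₂ = 𝟙 (E × E)` (the biproduct identity). [folklore] -/
private theorem p_comp_ι_add : fst E E ≫ prodLift (𝟙 E) (0 : E ⟶ E) + snd E E ≫ prodLift (0 : E ⟶ E) (𝟙 E) = 𝟙 (E.prod E) := by
  refine Motives.AbelianVariety.prod_hom_ext ?_ ?_
  · rw [Preadditive.add_comp, Category.assoc, Category.assoc, ι_comp_p.1.1, ι_comp_p.2.1,
      Category.comp_id, Limits.comp_zero, add_zero, Category.id_comp]
  · rw [Preadditive.add_comp, Category.assoc, Category.assoc, ι_comp_p.1.2, ι_comp_p.2.2,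
      Category.comp_id, Limits.comp_zero, zero_add, Category.id_comp]

/-- `ι₁^* p₁^* w = w`. [folklore] -/
private theorem map_ι₁_map_p₁ (w : complexBetti E.X 1) :
    complexBetti.map (prodLift (𝟙 E) (0 : E ⟶ E)).hom.hom.hom 1 (complexBetti.map (fst E E).hom.hom.hom 1 w) = w := by
  rw [complexBetti_map_map_hom, ι_comp_p.1.1]
  change complexBetti.map (𝟙 E.X) 1 w = w
  rw [complexBetti.map_id]; rfl

/-- `ι₂^* p₂^* w = w`. [folklore] -/
private theorem map_ι₂_map_p₂ (w : complexBetti E.X 1) :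
    complexBetti.map (prodLift (0 : E ⟶ E) (𝟙 E)).hom.hom.hom 1 (complexBetti.map (snd E E).hom.hom.hom 1 w) = w := by
  rw [complexBetti_map_map_hom, ι_comp_p.2.2]
  change complexBetti.map (𝟙 E.X) 1 w = w
  rw [complexBetti.map_id]; rfl

/-- `ι₁^* p₂^* w = 0`. [folklore] -/
private theorem map_ι₁_map_p₂ (w : complexBetti E.X 1) :
    complexBetti.map (prodLift (𝟙 E) (0 : E ⟶ E)).hom.hom.hom 1 (complexBetti.map (snd E E).hom.hom.hom 1 w) = 0 := by
  rw [complexBetti_map_map_hom, ι_comp_p.1.2, complexBetti_map_zero_deg_one]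

/-- `ι₂^* p₁^* w = 0`. [folklore] -/
private theorem map_ι₂_map_p₁ (w : complexBetti E.X 1) :
    complexBetti.map (prodLift (0 : E ⟶ E) (𝟙 E)).hom.hom.hom 1 (complexBetti.map (fst E E).hom.hom.hom 1 w) = 0 := by
  rw [complexBetti_map_map_hom, ι_comp_p.2.1, complexBetti_map_zero_deg_one]

/-- `v = p₁^* ι₁^* v + p₂^* ι₂^* v` on `H¹(E × E)`.
[cite: LangeBirkenhake1992, §1.2 and Thm. 4.2.1] -/
theorem eq_map_p₁_add_map_p₂ (v : complexBetti (E.prod E).X 1) :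
    v = complexBetti.map (fst E E).hom.hom.hom 1 (complexBetti.map (prodLift (𝟙 E) (0 : E ⟶ E)).hom.hom.hom 1 v) +
      complexBetti.map (snd E E).hom.hom.hom 1 (complexBetti.map (prodLift (0 : E ⟶ E) (𝟙 E)).hom.hom.hom 1 v) := by
  rw [complexBetti_map_map_hom, complexBetti_map_map_hom,
    ← complexBetti_map_add_deg_one, p_comp_ι_add]
  change v = complexBetti.map (𝟙 (E.prod E).X) 1 v
  rw [complexBetti.map_id]; rfl

/-- `p₁^*` is injective. [folklore] -/
private theorem map_p₁_injective : Function.Injective (complexBetti.map (fst E E).hom.hom.hom 1) := fun a b h => by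
  rw [← map_ι₁_map_p₁ a, ← map_ι₁_map_p₁ b]
  exact congrArg _ h

/-! ### Endomorphisms of `E × E` act on `H¹` through `2 × 2` scalar matrices (non-CM `E`) -/

/-- For `ψ : E × E ⟶ E × E` and a non-CM `E`: `ψ^*(p_j^* w) = c₁ⱼ p₁^* w + c₂ⱼ p₂^* w` with
`c_ij` the scalar by which `ι_i ≫ ψ ≫ p_j` acts on `H¹(E)`.
[cite: MoonenZarhin1999LowDim, §2 (g = 1), Type I(1)] -/
theorem exists_map_map_p_eq (hT : EllipticCurve.HodgeEndTrivial E) (ψ : E.prod E ⟶ E.prod E) :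
    ∃ c : Fin 2 → Fin 2 → ℂ, ∀ w : complexBetti E.X 1,
      complexBetti.map ψ.hom.hom.hom 1 (complexBetti.map (fst E E).hom.hom.hom 1 w) =
          c 0 0 • complexBetti.map (fst E E).hom.hom.hom 1 w + c 1 0 • complexBetti.map (snd E E).hom.hom.hom 1 w ∧
        complexBetti.map ψ.hom.hom.hom 1 (complexBetti.map (snd E E).hom.hom.hom 1 w) =
          c 0 1 • complexBetti.map (fst E E).hom.hom.hom 1 w + c 1 1 • complexBetti.map (snd E E).hom.hom.hom 1 w := by
  obtain ⟨c₁₁, hc₁₁⟩ := exists_map_one_eq_smul hT (prodLift (𝟙 E) (0 : E ⟶ E) ≫ ψ ≫ fst E E)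
  obtain ⟨c₁₂, hc₁₂⟩ := exists_map_one_eq_smul hT (prodLift (𝟙 E) (0 : E ⟶ E) ≫ ψ ≫ snd E E)
  obtain ⟨c₂₁, hc₂₁⟩ := exists_map_one_eq_smul hT (prodLift (0 : E ⟶ E) (𝟙 E) ≫ ψ ≫ fst E E)
  obtain ⟨c₂₂, hc₂₂⟩ := exists_map_one_eq_smul hT (prodLift (0 : E ⟶ E) (𝟙 E) ≫ ψ ≫ snd E E)
  have key : ∀ (q : E.prod E ⟶ E), ψ ≫ q =
      fst E E ≫ (prodLift (𝟙 E) (0 : E ⟶ E) ≫ ψ ≫ q) + snd E E ≫ (prodLift (0 : E ⟶ E) (𝟙 E) ≫ ψ ≫ q) := by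
    intro q
    rw [← Category.assoc, ← Category.assoc, ← Category.assoc, ← Category.assoc,
      ← Preadditive.add_comp, ← Preadditive.add_comp, p_comp_ι_add, Category.id_comp]
  refine ⟨![![c₁₁, c₁₂], ![c₂₁, c₂₂]], fun w => ⟨?_, ?_⟩⟩
  · rw [complexBetti_map_map_hom, key, complexBetti_map_add_deg_one,
      ← complexBetti_map_map_hom (fst E E) (prodLift (𝟙 E) (0 : E ⟶ E) ≫ ψ ≫ fst E E),
      ← complexBetti_map_map_hom (snd E E) (prodLift (0 : E ⟶ E) (𝟙 E) ≫ ψ ≫ fst E E),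
      hc₁₁, hc₂₁, map_smul, map_smul]
    rfl
  · rw [complexBetti_map_map_hom, key, complexBetti_map_add_deg_one,
      ← complexBetti_map_map_hom (fst E E) (prodLift (𝟙 E) (0 : E ⟶ E) ≫ ψ ≫ snd E E),
      ← complexBetti_map_map_hom (snd E E) (prodLift (0 : E ⟶ E) (𝟙 E) ≫ ψ ≫ snd E E),
      hc₁₂, hc₂₂, map_smul, map_smul]
    rfl

/-- **An automorphism of `H¹(E × E)` of the shape `g ⊕ g` commutes with every endomorphism
pull-back** (non-CM `E`): if `u (p_i^* w) = p_i^* (g w)` for `i = 1, 2`, then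
`u (ψ^* v) = ψ^* (u v)` for every `ψ : E × E ⟶ E × E`.
[cite: Milne1999LefschetzClasses, §4 (the centralizer `C(A)`)] -/
theorem comm_map_of_diag (hT : EllipticCurve.HodgeEndTrivial E)
    {u : complexBetti (E.prod E).X 1 →ₗ[ℂ] complexBetti (E.prod E).X 1}
    {g : complexBetti E.X 1 →ₗ[ℂ] complexBetti E.X 1}
    (hu₁ : ∀ w, u (complexBetti.map (fst E E).hom.hom.hom 1 w) = complexBetti.map (fst E E).hom.hom.hom 1 (g w))
    (hu₂ : ∀ w, u (complexBetti.map (snd E E).hom.hom.hom 1 w) = complexBetti.map (snd E E).hom.hom.hom 1 (g w))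
    (ψ : E.prod E ⟶ E.prod E) (v : complexBetti (E.prod E).X 1) :
    u (complexBetti.map ψ.hom.hom.hom 1 v) = complexBetti.map ψ.hom.hom.hom 1 (u v) := by
  obtain ⟨c, hc⟩ := exists_map_map_p_eq hT ψ
  have huv : u v =
      complexBetti.map (fst E E).hom.hom.hom 1 (g (complexBetti.map (prodLift (𝟙 E) (0 : E ⟶ E)).hom.hom.hom 1 v)) +
        complexBetti.map (snd E E).hom.hom.hom 1 (g (complexBetti.map (prodLift (0 : E ⟶ E) (𝟙 E)).hom.hom.hom 1 v)) := by
    conv_lhs => rw [eq_map_p₁_add_map_p₂ v]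
    rw [map_add, hu₁, hu₂]
  rw [huv, map_add, (hc _).1, (hc _).2]
  conv_lhs => rw [eq_map_p₁_add_map_p₂ v]
  simp only [map_add, map_smul, (hc _).1, (hc _).2, hu₁, hu₂]

/-! ### The rotation `J`: `J ≫ p₁ = -p₂`, `J ≫ p₂ = p₁` -/

section Rotation

variable {J : E.prod E ⟶ E.prod E}

/-- `J ≫ J = -1` for the rotation. [cite: vanGeemen1994HodgeAV, 5.4] -/
theorem rot_comp_rot (hJ₁ : J ≫ fst E E = -(snd E E)) (hJ₂ : J ≫ snd E E = fst E E) : J ≫ J = -((1 : ℕ) • 𝟙 (E.prod E)) := by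
  rw [one_smul]
  refine Motives.AbelianVariety.prod_hom_ext ?_ ?_
  · rw [Category.assoc, hJ₁, Preadditive.comp_neg, hJ₂, Preadditive.neg_comp, Category.id_comp]
  · rw [Category.assoc, hJ₂, hJ₁, Preadditive.neg_comp, Category.id_comp]

/-- `J^* p₁^* w = -p₂^* w`. [folklore] -/
private theorem map_rot_map_p₁ (hJ₁ : J ≫ fst E E = -(snd E E)) (w : complexBetti E.X 1) :
    complexBetti.map J.hom.hom.hom 1 (complexBetti.map (fst E E).hom.hom.hom 1 w) =
      -complexBetti.map (snd E E).hom.hom.hom 1 w := by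
  rw [complexBetti_map_map_hom, hJ₁, complexBetti_map_neg_deg_one]

/-- `J^* p₂^* w = p₁^* w`. [folklore] -/
private theorem map_rot_map_p₂ (hJ₂ : J ≫ snd E E = fst E E) (w : complexBetti E.X 1) :
    complexBetti.map J.hom.hom.hom 1 (complexBetti.map (snd E E).hom.hom.hom 1 w) =
      complexBetti.map (fst E E).hom.hom.hom 1 w := by
  rw [complexBetti_map_map_hom, hJ₂]

/-- `p₁^* w ± i p₂^* w` is an eigenvector of `J^*` for `± i`. [cite: vanGeemen1994HodgeAV, 5.4] -/
theorem map_p₁_add_smul_map_p₂_mem_eigenspace (hJ₁ : J ≫ fst E E = -(snd E E)) (hJ₂ : J ≫ snd E E = fst E E)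
    {ε : ℂ} (hε : ε * ε = -1) (w : complexBetti E.X 1) :
    complexBetti.map (fst E E).hom.hom.hom 1 w + ε • complexBetti.map (snd E E).hom.hom.hom 1 w ∈
      Module.End.eigenspace (complexBetti.map J.hom.hom.hom 1).hom ε := by
  rw [Module.End.mem_eigenspace_iff]
  change complexBetti.map J.hom.hom.hom 1 _ = _
  rw [map_add, map_smul, map_rot_map_p₁ hJ₁, map_rot_map_p₂ hJ₂, smul_add, smul_smul, hε, neg_one_smul]
  abel

/-- An eigenvector of `J^*` for `ε = ± i` is `p₁^* w + ε p₂^* w` with `w = ι₁^* v`.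
[cite: vanGeemen1994HodgeAV, 5.4] -/
theorem eq_of_mem_eigenspace_rot (hJ₁ : J ≫ fst E E = -(snd E E)) (hJ₂ : J ≫ snd E E = fst E E) {ε : ℂ}
    {v : complexBetti (E.prod E).X 1} (hv : v ∈ Module.End.eigenspace (complexBetti.map J.hom.hom.hom 1).hom ε) :
    v = complexBetti.map (fst E E).hom.hom.hom 1 (complexBetti.map (prodLift (𝟙 E) (0 : E ⟶ E)).hom.hom.hom 1 v) +
      ε • complexBetti.map (snd E E).hom.hom.hom 1 (complexBetti.map (prodLift (𝟙 E) (0 : E ⟶ E)).hom.hom.hom 1 v) := by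
  rw [Module.End.mem_eigenspace_iff] at hv
  change complexBetti.map J.hom.hom.hom 1 v = ε • v at hv
  set a := complexBetti.map (prodLift (𝟙 E) (0 : E ⟶ E)).hom.hom.hom 1 v with ha
  set b := complexBetti.map (prodLift (0 : E ⟶ E) (𝟙 E)).hom.hom.hom 1 v with hb
  have hvab := eq_map_p₁_add_map_p₂ v
  rw [← ha, ← hb] at hvab
  -- `J^* v = -p₂^* a + p₁^* b = ε (p₁^* a + p₂^* b)`; apply `ι₁^*`: `b = ε a`
  have hJv : complexBetti.map J.hom.hom.hom 1 v =
      -complexBetti.map (snd E E).hom.hom.hom 1 a + complexBetti.map (fst E E).hom.hom.hom 1 b := by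
    conv_lhs => rw [hvab]
    rw [map_add, map_rot_map_p₁ hJ₁, map_rot_map_p₂ hJ₂]
  rw [hJv, hvab, smul_add] at hv
  have hb' : b = ε • a := by
    have h := congrArg (complexBetti.map (prodLift (𝟙 E) (0 : E ⟶ E)).hom.hom.hom 1) hv
    rw [map_add, map_add, map_neg, map_smul, map_smul, map_ι₁_map_p₂, map_ι₁_map_p₁, map_ι₁_map_p₁,
      map_ι₁_map_p₂, neg_zero, zero_add, smul_zero, add_zero] at h
    exact h
  rw [hvab, hb', map_smul]

end Rotation

/-! ### Alternating forms on the plane `H¹(E)` scale by the determinant -/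

/-- An alternating bilinear map on a `2`-dimensional space scales by the determinant under an
endomorphism: `γ(g x, g y) = det g • γ(x, y)`. [folklore] -/
private theorem bilin_apply_apply_eq_det_smul {V L : Type*} [AddCommGroup V] [Module ℂ V] [AddCommGroup L]
    [Module ℂ L] (e : Module.Basis (Fin 2) ℂ V) (γ : V →ₗ[ℂ] V →ₗ[ℂ] L) (hγ : ∀ x, γ x x = 0)
    (g : V →ₗ[ℂ] V) (x y : V) : γ (g x) (g y) = LinearMap.det g • γ x y := by
  classical
  have hskew : ∀ a b, γ b a = -γ a b := fun a b => by
    have h := hγ (a + b)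
    simp only [map_add, LinearMap.add_apply, hγ a, hγ b, zero_add, add_zero] at h
    -- `h : γ b a + γ a b = 0`
    exact eq_neg_of_add_eq_zero_left h
  -- `γ(a, b) = (a₀ b₁ - a₁ b₀) γ(e₀, e₁)`
  have hexp : ∀ a b, γ a b = (e.coord 0 a * e.coord 1 b - e.coord 1 a * e.coord 0 b) • γ (e 0) (e 1) := by
    intro a b
    conv_lhs => rw [eq_coord_smul_add e a, eq_coord_smul_add e b]
    simp only [map_add, map_smul, LinearMap.add_apply, LinearMap.smul_apply, hγ, hskew (e 0) (e 1)]
    module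
  -- coordinates of `g a`
  set M := LinearMap.toMatrix e e g with hM
  have hcoord : ∀ a (i : Fin 2), e.coord i (g a) = M i 0 * e.coord 0 a + M i 1 * e.coord 1 a := by
    intro a i
    have h := LinearMap.toMatrix_mulVec_repr e e g a
    have hi := congrFun h i
    rw [Matrix.mulVec, dotProduct, Fin.sum_univ_two] at hi
    rw [← hM] at hi
    change M i 0 * e.coord 0 a + M i 1 * e.coord 1 a = e.coord i (g a) at hi
    exact hi.symm
  rw [hexp (g x) (g y), hexp x y, hcoord x 0, hcoord x 1, hcoord y 0, hcoord y 1, smul_smul,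
    ← LinearMap.det_toMatrix e, ← hM, Matrix.det_fin_two]
  congr 1
  ring

/-! ### `SU_H(ℂ) ⊆ S(E × E)(ℂ)`: the special unitary group of the rotation is Milne's centraliser group -/

section Main

variable {J : E.prod E ⟶ E.prod E}

/-- **`SU_H(ℂ) ≤ S(E × E)(ℂ)` for the non-CM square.** For `E` an elliptic curve without complex
multiplication, `J` the rotation of `E × E` (`J ≫ p₁ = -p₂`, `J ≫ p₂ = p₁`) and the `K`-symmetrised
hyperplane class `h_K = e^*a + J^*e^*a` of any projective embedding `e` (`a` rational, non-zero), every
automorphism of `H¹((E × E)(ℂ); ℂ)` commuting with `J^*`, preserving `Q_{h_K}` and of determinant `1` on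
the two eigenspaces of `J^*` commutes with EVERY endomorphism pull-back (it is `g ⊕ g`, `g ∈ SL(H¹(E))`).
[cite: vanGeemen1994HodgeAV, Lemma 5.2 and 5.4] [cite: Milne1999LefschetzClasses, Thm. 4.4 and Prop. 4.8] [cite: MoonenZarhin1999LowDim, §2 (g = 1), Type I(1)] -/
theorem weilSpecialUnitaryGroup_le_unitaryCentralizerGroup (hE : E.dim = 1)
    (hT : EllipticCurve.HodgeEndTrivial E) (hJ₁ : J ≫ fst E E = -(snd E E)) (hJ₂ : J ≫ snd E E = fst E E)
    (e : Motives.ProjectiveEmbedding (E.prod E).X) {a : complexBetti (Motives.projectiveSpace e.n ℂ) 2}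
    (ha : IsRationalClass a) (ha0 : a ≠ 0) :
    weilSpecialUnitaryGroup (E.prod E) J 1 1
        (((1 : ℕ) : ℂ) • complexBetti.map e.ι 2 a + complexBetti.map J.hom.hom.hom 2 (complexBetti.map e.ι 2 a)) ≤
      Milne1999.unitaryCentralizerGroup (E.prod E)
        (((1 : ℕ) : ℂ) • complexBetti.map e.ι 2 a + complexBetti.map J.hom.hom.hom 2 (complexBetti.map e.ι 2 a)) := by
  classical
  intro u hu
  obtain ⟨hc, hQ, hdp, hdm⟩ := mem_weilSpecialUnitaryGroup_iff.1 hu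
  -- ambient data
  set hK := ((1 : ℕ) : ℂ) • complexBetti.map e.ι 2 a + complexBetti.map J.hom.hom.hom 2 (complexBetti.map e.ι 2 a)
    with hKdef
  have hA : (E.prod E).dim = 1 + 1 := by rw [Motives.AbelianVariety.dim_prod, hE]
  have hXA : IsSmoothProjective (1 + 1) (E.prod E).X := Motives.isSmoothProjective_of_dim_eq' hA
  have hXE : IsSmoothProjective E.dim E.X := Motives.AbelianVariety.isSmoothProjective_holds
  have hJJ : J ≫ J = -((1 : ℕ) • 𝟙 (E.prod E)) := rot_comp_rot hJ₁ hJ₂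
  have hμ : Complex.I * ((Real.sqrt ((1 : ℕ) : ℝ) : ℝ) : ℂ) = Complex.I := by simp
  rw [hμ] at hdp hdm
  have hI : Complex.I * Complex.I = -1 := Complex.I_mul_I
  have hnI : -Complex.I * -Complex.I = -1 := by rw [neg_mul_neg, Complex.I_mul_I]
  haveI : Module.Finite ℂ (complexBetti E.X 1) := finite_complexBetti_abelianVariety E 1
  haveI : Module.Finite ℂ (complexBetti (E.prod E).X 1) := finite_complexBetti_abelianVariety (E.prod E) 1
  -- the maps
  set P₁ := (complexBetti.map (fst E E).hom.hom.hom 1).hom with hP₁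
  set P₂ := (complexBetti.map (snd E E).hom.hom.hom 1).hom with hP₂
  set π₁ := (complexBetti.map (prodLift (𝟙 E) (0 : E ⟶ E)).hom.hom.hom 1).hom with hπ₁
  set TJ := (complexBetti.map J.hom.hom.hom 1).hom with hTJ
  set Q := Motives.polarizationPairingOne (E.prod E).X hK 1 with hQdef
  have hQ1 : ∀ x y, Q (u x) (u y) = Q x y := fun x y => hQ x y
  -- (1) `J^*`-invariance of `Q`, type `(1,1)`, isotropy of `H^{1,0}`, `H^{0,1}`
  have hQJ : ∀ x y, Q (TJ x) (TJ y) = Q x y := by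
    intro x y
    calc Q (TJ x) (TJ y) = ((1 : ℕ) : ℂ) • Q x y := polarizationPairingOne_map_map_ksymm hA one_pos hJJ e a x y
      _ = Q x y := by rw [Nat.cast_one, one_smul]
  have h11 : IsOfHodgeType (1 + 1) (E.prod E).X 2 1 1 hK := isOfHodgeType_one_one_ksymm hA one_pos J e ha ha0
  have hiso10 : ∀ z z', z ∈ hodgeOneZero hXA → z' ∈ hodgeOneZero hXA → Q z z' = 0 := fun z z' hz hz' =>
    polarizationPairingOne_eq_zero_of_mem_hodgeOneZero hXA h11 hz hz'
  have hiso01 : ∀ z z', z ∈ hodgeZeroOne hXA → z' ∈ hodgeZeroOne hXA → Q z z' = 0 := fun z z' hz hz' =>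
    polarizationPairingOne_eq_zero_of_mem_hodgeZeroOne hXA h11 hz hz'
  have hKrat : IsRationalClass hK := by
    have h1 : IsRationalClass (complexBetti.map e.ι 2 a) := ha.map _
    have h2 : IsRationalClass (complexBetti.map J.hom.hom.hom 2 (complexBetti.map e.ι 2 a)) := h1.map _
    have e1 : ((1 : ℕ) : ℂ) • complexBetti.map e.ι 2 a = ((1 : ℚ) : ℂ) • complexBetti.map e.ι 2 a := by
      rw [Nat.cast_one, Rat.cast_one]
    rw [hKdef, e1]
    exact (h1.smul 1).add h2
  -- (2) the cross pairing `β(w, w') = Q(p₁^* w, p₂^* w')` vanishes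
  have hβsymm : ∀ w w', Q (P₁ w) (P₂ w') = Q (P₁ w') (P₂ w) := by
    intro w w'
    have h := hQJ (P₂ w) (P₁ w')
    have e1 : TJ (P₂ w) = P₁ w := map_rot_map_p₂ hJ₂ w
    have e2 : TJ (P₁ w') = -P₂ w' := map_rot_map_p₁ hJ₁ w'
    rw [e1, e2, map_neg, polarizationPairingOne_swap hK 1 (P₁ w') (P₂ w)] at h
    exact neg_injective h
  have hβalt : ∀ w, Q (P₁ w) (P₂ w) = 0 := by
    -- Lemma K: the non-CM input
    have hX4 : IsSmoothProjective 2 (E.prod E).X := Motives.isSmoothProjective_of_dim_eq' (by rw [hA])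
    have hL1' : ∀ k, k = 2 * 2 → Module.finrank ℂ (complexBetti (E.prod E).X k) = 1 := by
      intro k hk; subst hk; exact finrank_complexBetti_two_mul_eq_one (n := 2) hX4
    have hL1 : Module.finrank ℂ (complexBetti (E.prod E).X (2 + 2 * 1)) = 1 := hL1' _ (by norm_num)
    -- a rational generator `ℓ` of the top cohomology
    obtain ⟨ℓ, hℓrat, hℓ0⟩ :
        ∃ ℓ : complexBetti (E.prod E).X (2 + 2 * 1), IsRationalClass ℓ ∧ ℓ ≠ 0 := by
      by_contra hcon
      push Not at hcon
      have hbot : Submodule.span ℂ {c : complexBetti (E.prod E).X (2 + 2 * 1) | IsRationalClass c} = ⊥ :=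
        Submodule.span_eq_bot.2 fun c hc => hcon c hc
      rw [span_isRationalClass_eq_top_of_isSmoothProjective_holds _ _ hX4 (2 + 2 * 1)] at hbot
      haveI : Subsingleton (complexBetti (E.prod E).X (2 + 2 * 1)) :=
        subsingleton_of_forall_eq 0 fun c => (Submodule.mem_bot ℂ).1 (hbot ▸ Submodule.mem_top)
      rw [Module.finrank_zero_of_subsingleton] at hL1
      exact zero_ne_one hL1
    have hspan : Submodule.span ℂ (Set.range fun _ : Unit => ℓ) = ⊤ := by
      haveI : Module.Finite ℂ (complexBetti (E.prod E).X (2 + 2 * 1)) := finite_complexBetti_abelianVariety (E.prod E) _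
      rw [Set.range_const]
      exact (finrank_eq_one_iff_of_nonzero ℓ hℓ0).1 hL1
    let β : complexBetti E.X 1 →ₗ[ℂ] complexBetti E.X 1 →ₗ[ℂ] complexBetti (E.prod E).X (2 + 2 * 1) :=
      (Q.comp P₁).compl₂ P₂
    have hβ : ∀ w w', β w w' = Q (P₁ w) (P₂ w') := fun w w' => rfl
    have hrat : ∀ x y, IsRationalClass x → IsRationalClass y → ∃ q : ℚ, β x y = (q : ℂ) • ℓ := by
      intro x y hx hy
      have hval : IsRationalClass (β x y) := by
        rw [hβ, hQdef, polarizationPairingOne_eq_cupProduct_cupPowTwo]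
        exact (hx.map _).cup _ ((hy.map _).cup _ (hKrat.cupPowTwo 1))
      obtain ⟨q, hq⟩ := exists_rat_combination_of_isRationalClass (fun _ : Unit => hℓrat) hspan hval
      refine ⟨q (), ?_⟩
      rw [hq, Fintype.sum_unique]
    have h10 : ∀ x, IsOfHodgeType E.dim E.X 1 1 0 x → β x x = 0 := fun x hx =>
      hiso10 _ _ ((mem_hodgeOneZero hXA).2 (hx.map_of_isSmoothProjective hXA hXE _))
        ((mem_hodgeOneZero hXA).2 (hx.map_of_isSmoothProjective hXA hXE _))
    have h01 : ∀ x, IsOfHodgeType E.dim E.X 1 0 1 x → β x x = 0 := fun x hx =>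
      hiso01 _ _ ((mem_hodgeZeroOne hXA).2 (hx.map_of_isSmoothProjective hXA hXE _))
        ((mem_hodgeZeroOne hXA).2 (hx.map_of_isSmoothProjective hXA hXE _))
    intro w
    exact bilin_self_eq_zero_of_hodgeEndTrivial hE hT β hℓ0 hrat h10 h01 w
  have hβ0 : ∀ w w', Q (P₁ w) (P₂ w') = 0 := by
    intro w w'
    have h := hβalt (w + w')
    simp only [map_add, LinearMap.add_apply, hβalt w, hβalt w', zero_add, add_zero] at h
    rw [hβsymm w' w] at h
    have h2 : (2 : ℂ) • Q (P₁ w) (P₂ w') = 0 := by rw [two_smul]; exact h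
    exact (smul_eq_zero.1 h2).resolve_left two_ne_zero
  have hβ0' : ∀ w w', Q (P₂ w) (P₁ w') = 0 := fun w w' => by
    rw [polarizationPairingOne_swap, hβ0, neg_zero]
  -- (3) `Q(p₂^* w, p₂^* w') = Q(p₁^* w, p₁^* w')` and the block form of `Q`
  have hQ22 : ∀ w w', Q (P₂ w) (P₂ w') = Q (P₁ w) (P₁ w') := by
    intro w w'
    have e1 : TJ (P₁ w) = -P₂ w := map_rot_map_p₁ hJ₁ w
    have e2 : TJ (P₁ w') = -P₂ w' := map_rot_map_p₁ hJ₁ w'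
    have h := hQJ (P₁ w) (P₁ w')
    rw [e1, e2, map_neg, map_neg, LinearMap.neg_apply, neg_neg] at h
    exact h
  have hQblock : ∀ a₁ b₁ a₂ b₂ : complexBetti E.X 1, ∀ c d : ℂ,
      Q (P₁ a₁ + c • P₂ b₁) (P₁ a₂ + d • P₂ b₂) =
        Q (P₁ a₁) (P₁ a₂) + (c * d) • Q (P₁ b₁) (P₁ b₂) := by
    intro a₁ b₁ a₂ b₂ c d
    simp only [map_add, map_smul, LinearMap.add_apply, LinearMap.smul_apply, hβ0, hβ0', hQ22, smul_zero,
      add_zero, zero_add, smul_smul, mul_comm d c]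
  -- (4) non-degeneracy of `γ(w, w') = Q(p₁^* w, p₁^* w')`
  have hHL : Literature.Geometry.Kaehler.HasHardLefschetzProperty hK (E.prod E).dim := by
    obtain ⟨s, H', hs, hH', hsH⟩ := exists_isKaehlerClass_ksymm_eq_smul hA one_pos J e ha ha0
    rw [hA]
    have h1 : Literature.Geometry.Kaehler.HasHardLefschetzProperty H' (1 + 1) :=
      hH'.hasHardLefschetzProperty hXA fun _ => Motives.hasHardLefschetzProperty_kaehlerClass_holds
    have h2 := HasHardLefschetzProperty.smul h1 (Complex.ofReal_ne_zero.2 hs)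
    rwa [← hsH] at h2
  have hnd : ∀ x : complexBetti (E.prod E).X 1, (∀ y, Q x y = 0) → x = 0 := by
    intro x hx
    refine Milne1999.eq_zero_of_forall_polarizationPairingOne_eq_zero_of_hasHardLefschetzProperty
      (A := E.prod E) (by rw [hA]; omega) hHL fun y => ?_
    have key : ∀ j, j = 1 → Motives.polarizationPairingOne (E.prod E).X hK j x y = 0 := by
      intro j hj; subst hj; exact hx y
    exact key ((E.prod E).dim - 1) (by rw [hA])
  have hγnd : ∀ z : complexBetti E.X 1, (∀ w, Q (P₁ w) (P₁ z) = 0) → z = 0 := by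
    intro z hz
    have hP1z : P₁ z = 0 := by
      refine hnd (P₁ z) fun y => ?_
      rw [eq_map_p₁_add_map_p₂ y]
      change Q (P₁ z) (P₁ _ + P₂ _) = 0
      rw [map_add, hβ0, add_zero, polarizationPairingOne_swap, hz, neg_zero]
    exact map_p₁_injective (by rw [map_zero]; exact hP1z)
  -- (5) the eigenvectors `x_ε(w) = p₁^* w + ε p₂^* w`, `ε = ± i`, and the blocks `g_ε` of `u`
  have hmem : ∀ {ε : ℂ}, ε * ε = -1 → ∀ w, P₁ w + ε • P₂ w ∈ Module.End.eigenspace TJ ε :=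
    fun hε w => map_p₁_add_smul_map_p₂_mem_eigenspace hJ₁ hJ₂ hε w
  have hπx : ∀ (ε : ℂ) w, π₁ (P₁ w + ε • P₂ w) = w := by
    intro ε w
    rw [map_add, map_smul]
    change complexBetti.map (prodLift (𝟙 E) (0 : E ⟶ E)).hom.hom.hom 1 (complexBetti.map (fst E E).hom.hom.hom 1 w) +
      ε • complexBetti.map (prodLift (𝟙 E) (0 : E ⟶ E)).hom.hom.hom 1 (complexBetti.map (snd E E).hom.hom.hom 1 w) = w
    rw [map_ι₁_map_p₁, map_ι₁_map_p₂, smul_zero, add_zero]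
  -- the block of `u` on the `ε`-eigenspace, read on `H¹(E)`
  have hblock : ∀ {ε : ℂ} (hε : ε * ε = -1), ∃ g : complexBetti E.X 1 →ₗ[ℂ] complexBetti E.X 1,
      (∀ w, u (P₁ w + ε • P₂ w) = P₁ (g w) + ε • P₂ (g w)) ∧
        LinearMap.det g = detOnEigenspace u TJ hc ε := by
    intro ε hε
    let xε : complexBetti E.X 1 →ₗ[ℂ] complexBetti (E.prod E).X 1 := P₁ + ε • P₂
    have hxε : ∀ w, xε w = P₁ w + ε • P₂ w := fun w => rfl
    let g : complexBetti E.X 1 →ₗ[ℂ] complexBetti E.X 1 :=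
      π₁ ∘ₗ (u : complexBetti (E.prod E).X 1 →ₗ[ℂ] complexBetti (E.prod E).X 1) ∘ₗ xε
    have hg : ∀ w, g w = π₁ (u (P₁ w + ε • P₂ w)) := fun w => rfl
    have hug : ∀ w, u (P₁ w + ε • P₂ w) = P₁ (g w) + ε • P₂ (g w) := by
      intro w
      have hm : u (P₁ w + ε • P₂ w) ∈ Module.End.eigenspace TJ ε := mapsTo_eigenspace_of_comm hc ε (hmem hε w)
      have h := eq_of_mem_eigenspace_rot hJ₁ hJ₂ hm
      rw [hg]
      exact h
    refine ⟨g, hug, ?_⟩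
    -- the comparison isomorphism `Φ : H¹(E) ≃ V_ε`
    let Φ : complexBetti E.X 1 ≃ₗ[ℂ] Module.End.eigenspace TJ ε :=
      { toFun := fun w => ⟨P₁ w + ε • P₂ w, hmem hε w⟩
        map_add' := fun w w' => by
          ext; simp only [map_add, smul_add, Submodule.coe_add]; abel
        map_smul' := fun c w => by
          ext; simp only [map_smul, smul_add, smul_smul, mul_comm c ε, RingHom.id_apply, Submodule.coe_smul]
        invFun := fun v => π₁ v.1
        left_inv := fun w => hπx ε w
        right_inv := fun v => by
          ext
          exact (eq_of_mem_eigenspace_rot hJ₁ hJ₂ v.2).symm }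
    have hΦ : ∀ w, (Φ w : complexBetti (E.prod E).X 1) = P₁ w + ε • P₂ w := fun w => rfl
    have hconj : (u : complexBetti (E.prod E).X 1 →ₗ[ℂ] complexBetti (E.prod E).X 1).restrict
          (mapsTo_eigenspace_of_comm hc ε) =
        (Φ : complexBetti E.X 1 →ₗ[ℂ] Module.End.eigenspace TJ ε) ∘ₗ g ∘ₗ
          (Φ.symm : Module.End.eigenspace TJ ε →ₗ[ℂ] complexBetti E.X 1) := by
      ext v
      rw [LinearMap.restrict_apply, LinearMap.comp_apply, LinearMap.comp_apply]
      change (u v.1 : complexBetti (E.prod E).X 1) = (Φ (g (Φ.symm v)) : complexBetti (E.prod E).X 1)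
      rw [hΦ, ← hug]
      congr 1
      have hv := eq_of_mem_eigenspace_rot hJ₁ hJ₂ v.2
      exact hv
    rw [detOnEigenspace, hconj, LinearMap.det_conj]
  obtain ⟨g, hug, hdetg⟩ := hblock hI
  obtain ⟨g', hug', hdetg'⟩ := hblock hnI
  rw [hdp] at hdetg
  rw [hdm] at hdetg'
  -- (6) `γ(g w, g' w') = γ(w, w')` from the invariance of `Q`, `γ(g w, g w') = γ(w, w')` from `det g = 1`
  have hγgg' : ∀ w w', Q (P₁ (g w)) (P₁ (g' w')) = Q (P₁ w) (P₁ w') := by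
    intro w w'
    have h := hQ1 (P₁ w + Complex.I • P₂ w) (P₁ w' + -Complex.I • P₂ w')
    rw [hug, hug', hQblock, hQblock] at h
    have hc1 : Complex.I * -Complex.I = 1 := by rw [mul_neg, Complex.I_mul_I, neg_neg]
    rw [hc1, one_smul, one_smul] at h
    have h2 : (2 : ℂ) • Q (P₁ (g w)) (P₁ (g' w')) = (2 : ℂ) • Q (P₁ w) (P₁ w') := by
      rw [two_smul, two_smul]; exact h
    exact smul_right_injective _ (two_ne_zero (α := ℂ)) h2
  obtain ⟨eW, -⟩ := EllipticCurve.exists_rational_basis hE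
  let γ : complexBetti E.X 1 →ₗ[ℂ] complexBetti E.X 1 →ₗ[ℂ] complexBetti (E.prod E).X (2 + 2 * 1) :=
    (Q.comp P₁).compl₂ P₁
  have hγ : ∀ w w', γ w w' = Q (P₁ w) (P₁ w') := fun w w' => rfl
  have hγalt : ∀ w, γ w w = 0 := fun w => polarizationPairingOne_self hK 1 (P₁ w)
  have hγgg : ∀ w w', Q (P₁ (g w)) (P₁ (g w')) = Q (P₁ w) (P₁ w') := by
    intro w w'
    have h := bilin_apply_apply_eq_det_smul eW γ hγalt g w w'
    rw [hγ, hγ, hdetg, one_smul] at h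
    exact h
  -- (7) `g' = g`
  have hgsurj : Function.Surjective g := by
    have hu : IsUnit g := (LinearMap.isUnit_iff_isUnit_det g).2 (by rw [hdetg]; exact isUnit_one)
    exact LinearMap.range_eq_top.1 ((LinearMap.isUnit_iff_range_eq_top g).1 hu)
  have hgg' : ∀ w, g' w = g w := by
    intro w'
    have hz : ∀ w, Q (P₁ w) (P₁ (g' w' - g w')) = 0 := by
      intro x
      obtain ⟨w, rfl⟩ := hgsurj x
      rw [map_sub, map_sub, hγgg', hγgg, sub_self]
    exact sub_eq_zero.1 (hγnd _ hz)
  -- (8) `u = g ⊕ g`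
  have hu₁ : ∀ w, u (P₁ w) = P₁ (g w) := by
    intro w
    have h1 := hug w
    have h2 := hug' w
    rw [hgg'] at h2
    have h : u (P₁ w + Complex.I • P₂ w) + u (P₁ w + -Complex.I • P₂ w) =
        (2 : ℂ) • P₁ (g w) := by rw [h1, h2]; module
    have e2 : P₁ w + Complex.I • P₂ w + (P₁ w + -Complex.I • P₂ w) = (2 : ℂ) • P₁ w := by module
    rw [← map_add, e2, map_smul] at h
    exact smul_right_injective _ (two_ne_zero (α := ℂ)) h
  have hu₂ : ∀ w, u (P₂ w) = P₂ (g w) := by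
    intro w
    have h1 := hug w
    have h2 := hug' w
    rw [hgg'] at h2
    have h : u (P₁ w + Complex.I • P₂ w) - u (P₁ w + -Complex.I • P₂ w) =
        ((2 : ℂ) * Complex.I) • P₂ (g w) := by rw [h1, h2]; module
    have e2 : P₁ w + Complex.I • P₂ w - (P₁ w + -Complex.I • P₂ w) = ((2 : ℂ) * Complex.I) • P₂ w := by
      module
    rw [← map_sub, e2, map_smul] at h
    exact smul_right_injective _ (mul_ne_zero (two_ne_zero (α := ℂ)) Complex.I_ne_zero) h
  -- (9) conclusion
  refine Milne1999.mem_unitaryCentralizerGroup_iff.2 ⟨Milne1999.mem_centralizerGroup_iff.2 fun ψ x => ?_, ?_⟩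
  · exact comm_map_of_diag hT (u := (u : complexBetti (E.prod E).X 1 →ₗ[ℂ] complexBetti (E.prod E).X 1))
      hu₁ hu₂ ψ x
  · have key : ∀ j, j = 1 → ∀ x y, Motives.polarizationPairingOne (E.prod E).X hK j (u x) (u y) =
        Motives.polarizationPairingOne (E.prod E).X hK j x y := by
      intro j hj; subst hj; exact hQ1
    exact key ((E.prod E).dim - 1) (by rw [hA])

end Main

section Assembly

variable {J : E.prod E ⟶ E.prod E}

/-- **Tate / Murasaki for all powers of `E × E`.** Every power `(E × E)^{N+1}` of the square of an
elliptic curve without complex multiplication carries a slot structure, hence its Hodge ring is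
generated by divisor classes (`Bᵖ = Dᵖ` for all `p`). [cite: vanGeemen1994HodgeAV, Thm. 4.3]
[cite: Gordon1997, §3] [cite: MoonenZarhin1999LowDim, §2 (g = 1), Type I(1)] -/
theorem isDivisorGenerated_powSucc (hE : E.dim = 1) (hT : EllipticCurve.HodgeEndTrivial E) (N : ℕ) :
    IsDivisorGenerated ((E.prod E).powSucc N) := by
  have key : ∀ M : ℕ, ∃ (n : ℕ) (g : Fin n → ((E.prod E).powSucc M ⟶ E)),
      EllSlots E ((E.prod E).powSucc M) g := by
    intro M
    induction M with
    | zero => exact ⟨_, _, (ellSlots_self hE).prod (ellSlots_self hE)⟩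
    | succ M ih =>
      obtain ⟨n, g, hg⟩ := ih
      exact ⟨_, _, hg.prod ((ellSlots_self hE).prod (ellSlots_self hE))⟩
  obtain ⟨n, g, hg⟩ := key N
  exact fun p c hcQ hc => hg.hodgeClasses_divisorial hE hT p c hcQ hc

/-- **The rotation `J` of `E × E` is balanced**: `dim (V_i ∩ H^{1,0}) = 1` (`V_i` the `i`-eigenspace of
`J^*` on `H¹`), i.e. `(E × E, ℚ(i))` is of Weil type with `n = 1` (van Geemen 5.4: the eigenvalues of
`J^*` on `H^{1,0} = p₁^* H^{1,0}(E) ⊕ p₂^* H^{1,0}(E)` are `i, -i`). [cite: vanGeemen1994HodgeAV, 5.2–5.4] -/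
theorem finrank_eigenspace_inf_hodgeOneZero (hE : E.dim = 1) (hJ₁ : J ≫ fst E E = -(snd E E)) (hJ₂ : J ≫ snd E E = fst E E)
    (hA2 : (E.prod E).dim = 2 * 1) :
    Module.finrank ℂ ↥(Module.End.eigenspace (complexBetti.map J.hom.hom.hom 1).hom Complex.I ⊓
      hodgeOneZero (Motives.isSmoothProjective_of_dim_eq' hA2)) = 1 := by
  have hJJ : J ≫ J = -((1 : ℕ) • 𝟙 (E.prod E)) := rot_comp_rot hJ₁ hJ₂
  have hab := finrank_inf_hodgeOneZero_add_finrank_inf_hodgeZeroOne hA2 one_pos hJJ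
  have hμ : Complex.I * ((Real.sqrt ((1 : ℕ) : ℝ) : ℝ) : ℂ) = Complex.I := by simp
  rw [hμ] at hab
  have hXA : IsSmoothProjective (2 * 1) (E.prod E).X := Motives.isSmoothProjective_of_dim_eq' hA2
  have hXE : IsSmoothProjective E.dim E.X := Motives.AbelianVariety.isSmoothProjective_holds
  haveI : Module.Finite ℂ (complexBetti (E.prod E).X 1) := finite_complexBetti_abelianVariety (E.prod E) 1
  obtain ⟨f, hf0, -, hf1⟩ := EllipticCurve.exists_hodge_basis hE
  have hI : Complex.I * Complex.I = -1 := Complex.I_mul_I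
  have hf1' : IsOfHodgeType E.dim E.X 1 0 1 (f 1) := by rw [hf1]; exact hf0.conjClass hXE
  -- the vectors `p₁^* ω + i p₂^* ω`, `ω = f 0, f 1`, are non-zero `i`-eigenvectors of the two types
  have hne : ∀ j, complexBetti.map (fst E E).hom.hom.hom 1 (f j) +
      Complex.I • complexBetti.map (snd E E).hom.hom.hom 1 (f j) ≠ 0 := by
    intro j h
    have h' := congrArg (complexBetti.map (prodLift (𝟙 E) (0 : E ⟶ E)).hom.hom.hom 1) h
    rw [map_add, map_smul, map_ι₁_map_p₁, map_ι₁_map_p₂, smul_zero, add_zero, map_zero] at h'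
    exact f.ne_zero j h'
  have hpos : ∀ (S : Submodule ℂ (complexBetti (E.prod E).X 1)) (j : Fin 2),
      complexBetti.map (fst E E).hom.hom.hom 1 (f j) + Complex.I • complexBetti.map (snd E E).hom.hom.hom 1 (f j) ∈ S →
        1 ≤ Module.finrank ℂ ↥(Module.End.eigenspace (complexBetti.map J.hom.hom.hom 1).hom Complex.I ⊓ S) := by
    intro S j hj
    refine Nat.one_le_iff_ne_zero.2 fun h0 => ?_
    have hmem : complexBetti.map (fst E E).hom.hom.hom 1 (f j) + Complex.I • complexBetti.map (snd E E).hom.hom.hom 1 (f j) ∈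
        Module.End.eigenspace (complexBetti.map J.hom.hom.hom 1).hom Complex.I ⊓ S :=
      ⟨map_p₁_add_smul_map_p₂_mem_eigenspace hJ₁ hJ₂ hI (f j), hj⟩
    rw [Submodule.finrank_eq_zero] at h0
    rw [h0, Submodule.mem_bot] at hmem
    exact hne j hmem
  have h10 : 1 ≤ Module.finrank ℂ ↥(Module.End.eigenspace (complexBetti.map J.hom.hom.hom 1).hom Complex.I ⊓
      hodgeOneZero (Motives.isSmoothProjective_of_dim_eq' hA2)) :=
    hpos _ 0 ((mem_hodgeOneZero hXA).2 ((hf0.map_of_isSmoothProjective hXA hXE _).add hXA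
      ((hf0.map_of_isSmoothProjective hXA hXE _).smul _)))
  have h01 : 1 ≤ Module.finrank ℂ ↥(Module.End.eigenspace (complexBetti.map J.hom.hom.hom 1).hom Complex.I ⊓
      hodgeZeroOne (Motives.isSmoothProjective_of_dim_eq' hA2)) :=
    hpos _ 1 ((mem_hodgeZeroOne hXA).2 ((hf1'.map_of_isSmoothProjective hXA hXE _).add hXA
      ((hf1'.map_of_isSmoothProjective hXA hXE _).smul _)))
  omega

/-- **The Weil classes of `(E × E, ℚ(i))` are Hodge classes** (`⋀²_K H¹ ⊂ B¹`, van Geemen Lemma 5.2 (6) /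
4.10 for the balanced rotation). [cite: vanGeemen1994HodgeAV, 4.10 and Lemma 5.2 (6)] -/
theorem isOfHodgeType_of_mem_weilClassesOf_rot (hE : E.dim = 1) (hJ₁ : J ≫ fst E E = -(snd E E)) (hJ₂ : J ≫ snd E E = fst E E)
    (hA2 : (E.prod E).dim = 2 * 1) :
    ∀ c ∈ weilClassesOf (E.prod E) J 1 1, IsOfHodgeType (2 * 1) (E.prod E).X (2 * 1) 1 1 c := by
  intro c hc
  refine isOfHodgeType_of_mem_weilClassesOf one_pos hA2 one_pos (rot_comp_rot hJ₁ hJ₂) ?_ hc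
  have hμ : Complex.I * ((Real.sqrt ((1 : ℕ) : ℝ) : ℝ) : ℂ) = Complex.I := by simp
  rw [hμ]
  exact finrank_eigenspace_inf_hodgeOneZero hE hJ₁ hJ₂ hA2

/-- **`Hod(E × E) = SU_H` for the non-CM square** in van Geemen's sense (`HasHodgeGroupSU`, 6.11): the
degree-one Hodge group of `E × E` is `S(E × E) = U(C)(h_K)` (Milne 1999, Thm. 4.4 with Tate/Murasaki
`B = D` on all powers), and `SU_H(ℂ) ≤ U(C)(h_K)` (`weilSpecialUnitaryGroup_le_unitaryCentralizerGroup`),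
while `Hod ≤ SU_H` always. [cite: vanGeemen1994HodgeAV, Thm. 6.11 and Lemma 5.2] [cite: Milne1999LefschetzClasses, Thm. 4.4 and Prop. 4.8] -/
theorem hasHodgeGroupSU (hE : E.dim = 1) (hT : EllipticCurve.HodgeEndTrivial E)
    (hJ₁ : J ≫ fst E E = -(snd E E)) (hJ₂ : J ≫ snd E E = fst E E) (e : Motives.ProjectiveEmbedding (E.prod E).X)
    {a : complexBetti (Motives.projectiveSpace e.n ℂ) 2} (ha : IsRationalClass a) (ha0 : a ≠ 0) :
    HasHodgeGroupSU (E.prod E) J 1 1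
      (((1 : ℕ) : ℂ) • complexBetti.map e.ι 2 a + complexBetti.map J.hom.hom.hom 2 (complexBetti.map e.ι 2 a)) := by
  have hA : (E.prod E).dim = 1 + 1 := by rw [Motives.AbelianVariety.dim_prod, hE]
  have hA2 : (E.prod E).dim = 2 * 1 := by rw [hA]
  have hJJ : J ≫ J = -((1 : ℕ) • 𝟙 (E.prod E)) := rot_comp_rot hJ₁ hJ₂
  have hW := isOfHodgeType_of_mem_weilClassesOf_rot hE hJ₁ hJ₂ hA2
  have hle := weilSpecialUnitaryGroup_le_unitaryCentralizerGroup hE hT hJ₁ hJ₂ e ha ha0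
  obtain ⟨s, H', hs, hH', hsH⟩ := exists_isKaehlerClass_ksymm_eq_smul hA one_pos J e ha ha0
  set hK := ((1 : ℕ) : ℂ) • complexBetti.map e.ι 2 a + complexBetti.map J.hom.hom.hom 2 (complexBetti.map e.ι 2 a)
    with hKdef
  have hKrat : IsRationalClass hK := by
    have h1 : IsRationalClass (complexBetti.map e.ι 2 a) := ha.map _
    have h2 : IsRationalClass (complexBetti.map J.hom.hom.hom 2 (complexBetti.map e.ι 2 a)) := h1.map _
    have e1 : ((1 : ℕ) : ℂ) • complexBetti.map e.ι 2 a = ((1 : ℚ) : ℂ) • complexBetti.map e.ι 2 a := by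
      rw [Nat.cast_one, Rat.cast_one]
    rw [hKdef, e1]
    exact (h1.smul 1).add h2
  have h11 : IsOfHodgeType (1 + 1) (E.prod E).X 2 1 1 hK := isOfHodgeType_one_one_ksymm hA one_pos J e ha ha0
  have hh : hK ∈ hodgeClassSpan (E.prod E).dim (E.prod E).X 1 := by
    refine Submodule.subset_span ⟨hKrat, ?_⟩
    rw [hA]
    exact h11
  refine (hasHodgeGroupSU_iff_weilSpecialUnitaryGroup_le one_pos one_pos hA2 hJJ hW hh).2 ?_
  have hdiv : ∀ N, IsDivisorGenerated ((E.prod E).powSucc N) := isDivisorGenerated_powSucc hE hT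
  have hsC : (s : ℂ) ≠ 0 := Complex.ofReal_ne_zero.2 hs
  rcases lt_or_gt_of_ne hs with hneg | hpos
  · -- `s < 0`: use the class `-h_K`, a positive multiple of a Kähler class, `U(C)(-h_K) = U(C)(h_K)`
    have hKrat' : IsRationalClass (-hK) := by
      have h := hKrat.smul (-1)
      rwa [Rat.cast_neg, Rat.cast_one, neg_one_smul] at h
    have hc : (((-s)⁻¹ : ℝ) : ℂ) * (s : ℂ) = -1 := by
      rw [← Complex.ofReal_mul, ← neg_inv, neg_mul, inv_mul_cancel₀ hs, Complex.ofReal_neg, Complex.ofReal_one]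
    have hKneg : ∃ s' : ℝ, 0 < s' ∧ IsKaehlerClass (E.prod E).dim (E.prod E).X ((s' : ℂ) • -hK) := by
      refine ⟨(-s)⁻¹, inv_pos.2 (neg_pos.2 hneg), ?_⟩
      rw [hA, hsH, smul_neg, smul_smul, hc, neg_one_smul, neg_neg]
      exact hH'
    have hU : Milne1999.unitaryCentralizerGroup (E.prod E) (-hK) = Milne1999.unitaryCentralizerGroup (E.prod E) hK := by
      rw [← neg_one_smul ℂ hK]
      exact Milne1999.unitaryCentralizerGroup_smul (by norm_num) hK
    rw [Milne1999.hodgeGroupOne_eq_unitaryCentralizerGroup_of_forall_isDivisorGenerated' hKrat' hKneg hdiv, hU]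
    exact hle
  · have hc : ((s⁻¹ : ℝ) : ℂ) * (s : ℂ) = 1 := by
      rw [← Complex.ofReal_mul, inv_mul_cancel₀ hs, Complex.ofReal_one]
    have hKpos : ∃ s' : ℝ, 0 < s' ∧ IsKaehlerClass (E.prod E).dim (E.prod E).X ((s' : ℂ) • hK) := by
      refine ⟨s⁻¹, inv_pos.2 hpos, ?_⟩
      rw [hA, hsH, smul_smul, hc, one_smul]
      exact hH'
    rw [Milne1999.hodgeGroupOne_eq_unitaryCentralizerGroup_of_forall_isDivisorGenerated' hKrat hKpos hdiv]
    exact hle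

end Assembly

end Square

end NonCMSquare

/-! ### The refutation -/

/-- **Van Geemen's Theorem 6.12 as vendored (`VanGeemen1994_thm612`, all `n ≥ 1`) is false**, given an
elliptic curve `E` without complex multiplication: for `(X, K) = (E × E, ℚ(i))` (`n = d = 1`, `J` the
rotation) the hypothesis `Hod(X) = SU_H` holds (`NonCMSquare.hasHodgeGroupSU`), but the Weil plane
`W_K = ⋀²_K H¹ ⊂ H²` consists of Hodge classes of degree `2`, i.e. of DIVISOR classes (`D¹ = B¹`,
Lefschetz), so `Dⁿ ∩ W_K = W_K ≠ 0` — contradicting the asserted `Dⁿ ∩ W_K = 0`. In print 6.12 is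
stated for "general abelian varieties of Weil-type"; §5.4 treats `E × E ⊂ ℚ(i)` as the degenerate
member `B¹ ∋ W`. [cite: vanGeemen1994HodgeAV, Thm. 6.12, 5.4 and 2.4] -/
theorem not_vanGeemen1994_thm612_of_hodgeEndTrivial {E : AbelianVariety ℂ} (hE : E.dim = 1)
    (hT : EllipticCurve.HodgeEndTrivial E) : ¬ VanGeemen1994_thm612 := by
  intro h612
  obtain ⟨J, hJ₁, hJ₂⟩ : ∃ J : E.prod E ⟶ E.prod E,
      J ≫ Motives.AbelianVariety.fst E E = -Motives.AbelianVariety.snd E E ∧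
        J ≫ Motives.AbelianVariety.snd E E = Motives.AbelianVariety.fst E E :=
    ⟨Motives.AbelianVariety.prodLift (-Motives.AbelianVariety.snd E E) (Motives.AbelianVariety.fst E E),
      Motives.AbelianVariety.prodLift_fst _ _, Motives.AbelianVariety.prodLift_snd _ _⟩
  have hA : (E.prod E).dim = 1 + 1 := by rw [Motives.AbelianVariety.dim_prod, hE]
  have hA2 : (E.prod E).dim = 2 * 1 := by rw [hA]
  have hJJ : J ≫ J = -((1 : ℕ) • 𝟙 (E.prod E)) := NonCMSquare.rot_comp_rot hJ₁ hJ₂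
  have hX : IsSmoothProjective (2 * 1) (E.prod E).X := Motives.isSmoothProjective_of_dim_eq' hA2
  -- a projective embedding and a non-zero rational class on the ambient projective space
  let e : Motives.ProjectiveEmbedding (E.prod E).X := hX.isProjectiveOver.projectiveEmbedding
  have hN : 1 ≤ e.n := le_trans (by norm_num) (le_of_isClosedImmersion_projectiveSpace hX e.ι)
  obtain ⟨a, ha, ha0⟩ : ∃ a : complexBetti (Motives.projectiveSpace e.n ℂ) 2, IsRationalClass a ∧ a ≠ 0 := by
    have hP : IsSmoothProjective e.n (Motives.projectiveSpace e.n ℂ) := isSmoothProjective_projectiveSpace' e.n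
    have h1 : Module.finrank ℂ (complexBetti (Motives.projectiveSpace e.n ℂ) 2) = 1 :=
      finrank_complexBetti_projectiveSpace_two_mul_eq_one e.n (p := 1) hN
    have hspan := span_isRationalClass_eq_top_of_isSmoothProjective_holds e.n (Motives.projectiveSpace e.n ℂ) hP 2
    by_contra hcon
    have hbot : Submodule.span ℂ {c : complexBetti (Motives.projectiveSpace e.n ℂ) 2 | IsRationalClass c} = ⊥ :=
      Submodule.span_eq_bot.2 fun c hc => by_contra fun h0 => hcon ⟨c, hc, h0⟩
    rw [hspan] at hbot
    haveI : Subsingleton (complexBetti (Motives.projectiveSpace e.n ℂ) 2) :=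
      subsingleton_of_forall_eq 0 fun c => (Submodule.mem_bot ℂ).1 (hbot ▸ Submodule.mem_top)
    rw [Module.finrank_zero_of_subsingleton] at h1
    exact zero_ne_one h1
  have hW := NonCMSquare.isOfHodgeType_of_mem_weilClassesOf_rot hE hJ₁ hJ₂ hA2
  have hSU := NonCMSquare.hasHodgeGroupSU hE hT hJ₁ hJ₂ e ha ha0
  obtain ⟨-, -, -, -, h5⟩ := h612 (E.prod E) J 1 1 e a one_pos one_pos hA2 hJJ hW ha ha0 hSU
  -- `W_K ≤ D¹ ⊗ ℂ`: Weil classes are rational `(1,1)`-classes, i.e. divisor classes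
  have hWle : weilClassesOf (E.prod E) J 1 1 ≤
      Literature.Barriers.HodgeConjecture.divisorClassesSpan (E.prod E).X (E.prod E).dim 1 := by
    rw [weilClassesOf_eq_span_isRationalClass one_pos hA2 one_pos hJJ]
    refine Submodule.span_le.2 ?_
    rintro c ⟨hcQ, hcW⟩
    have hc11 : IsOfHodgeType (E.prod E).dim (E.prod E).X 2 1 1 c := by
      rw [hA2]
      exact hW c hcW
    have hmem := Literature.Barriers.HodgeConjecture.mem_divisorMonomials_one hcQ hc11
    have h1c : cupProduct (show 2 * 0 + 2 = 2 * (0 + 1) by ring)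
        (singularCohomology.one ℂ (Motives.ComplexPoints (E.prod E).X)) c = c := one_cupProduct c
    rw [h1c] at hmem
    exact Submodule.subset_span hmem
  have hbot : weilClassesOf (E.prod E) J 1 1 = ⊥ := h5.symm.eq_bot_of_le hWle
  have h2 := finrank_weilClassesOf_eq_two (Motives.AbelianVariety.hasExteriorCohomologyH1_complexPoints (E.prod E))
    (by rw [Motives.AbelianVariety.finrank_complexBetti_one, hA2]) one_pos one_pos hJJ
  rw [hbot, finrank_bot] at h2
  exact two_ne_zero h2.symm


end Literature.AlgebraicGeometry.VanGeemen1994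

end
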